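import Mathlib.Analysis.InnerProductSpace.PiL2
import Mathlib.Analysis.InnerProductSpace.Orthogonal
import Mathlib.Analysis.Normed.Module.Alternating.Basic
import Mathlib.LinearAlgebra.Matrix.Determinant.Basic
import Mathlib.LinearAlgebra.Matrix.NonsingularInverse
import Mathlib.Tactic.LinearCombination

/-!
# The wedge bracket `θ ∧ Ω` on `ℝ⁴` and its non-vanishing on hyperplanes under perturbation

Topic `Literature/Geometry/Symplectic`.  For a covector `θ` and a 2-form `Ω` on `ℝ⁴` the bracket
`E(θ, Ω)(a, b, c) = θ(a)Ω(b, c) - θ(b)Ω(a, c) + θ(c)Ω(a, b)` is the 3-form `θ ∧ Ω`; the contact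
condition for a hypersurface with unit normal `u`, contact form `θ` and trace `Ω` is
`E(θ, Ω) ≠ 0` on linearly independent triples of `u^⊥`.  This file records the elementary algebra
(the bracket is trilinear, alternating, bounded by `3‖θ‖‖Ω‖`) and the PERTURBATION LEMMA
`bracket_ne_zero_of_perturbation`: if `Ω₀` has nonzero Pfaffian `P` (so that
`E(½Ω₀(u,·), Ω₀) = ½ P det[u, ·, ·, ·]` by the Pfaffian identity) and `(θ, Ω)` is close to the
linear model `(½ Ω₀(u, ·), Ω₀)`, then `E(θ, Ω) ≠ 0` on `u^⊥` — granted that alternating trilinear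
forms on `u^⊥` are `det`-proportional with bound (the tree's
`alternating_three_restrict_orthogonal_four`, taken as a hypothesis in its exact form).  Used by
`ContactTypeSmallSpheres` (small spheres around a point of a symplectic chart are contact type).

References: McDuff–Salamon, *Introduction to Symplectic Topology* (2017), §3.5; folklore
multilinear algebra.
-/

noncomputable section

open scoped RealInnerProductSpace
open Set Function

namespace Literature.Geometry.Symplectic


/-! ### Two-forms on pairs: additivity, homogeneity, antisymmetry -/

/-- `Ω(a + a', b) = Ω(a, b) + Ω(a', b)`. [folklore] -/
theorem two_form_add_left (Ω : (EuclideanSpace ℝ (Fin 4)) [⋀^Fin 2]→L[ℝ] ℝ) (a a' b : (EuclideanSpace ℝ (Fin 4))) :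
    Ω ![a + a', b] = Ω ![a, b] + Ω ![a', b] := by
  have := Ω.vecCons_add ![b] a a'
  simpa using this

/-- `Ω(t • a, b) = t Ω(a, b)`. [folklore] -/
theorem two_form_smul_left (Ω : (EuclideanSpace ℝ (Fin 4)) [⋀^Fin 2]→L[ℝ] ℝ) (t : ℝ) (a b : (EuclideanSpace ℝ (Fin 4))) :
    Ω ![t • a, b] = t * Ω ![a, b] := by
  have := Ω.vecCons_smul ![b] t a
  simpa using this

/-- `Ω(b, a) = - Ω(a, b)`. [folklore] -/
theorem two_form_swap (Ω : (EuclideanSpace ℝ (Fin 4)) [⋀^Fin 2]→L[ℝ] ℝ) (a b : (EuclideanSpace ℝ (Fin 4))) : Ω ![b, a] = - Ω ![a, b] := by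
  have h := Ω.map_swap ![a, b] (i := 0) (j := 1) (by decide)
  have e : (![a, b] ∘ ⇑(Equiv.swap (0 : Fin 2) 1) : Fin 2 → (EuclideanSpace ℝ (Fin 4))) = ![b, a] := by
    funext i; fin_cases i <;> rfl
  rw [e] at h
  exact h

/-- `Ω(a, b + b') = Ω(a, b) + Ω(a, b')`. [folklore] -/
theorem two_form_add_right (Ω : (EuclideanSpace ℝ (Fin 4)) [⋀^Fin 2]→L[ℝ] ℝ) (a b b' : (EuclideanSpace ℝ (Fin 4))) :
    Ω ![a, b + b'] = Ω ![a, b] + Ω ![a, b'] := by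
  have h1 := two_form_swap Ω (b + b') a
  have h2 := two_form_swap Ω b a
  have h3 := two_form_swap Ω b' a
  have h4 := two_form_add_left Ω b b' a
  linarith

/-- `Ω(a, t • b) = t Ω(a, b)`. [folklore] -/
theorem two_form_smul_right (Ω : (EuclideanSpace ℝ (Fin 4)) [⋀^Fin 2]→L[ℝ] ℝ) (t : ℝ) (a b : (EuclideanSpace ℝ (Fin 4))) :
    Ω ![a, t • b] = t * Ω ![a, b] := by
  have h1 := two_form_swap Ω (t • b) a
  have h2 := two_form_swap Ω b a
  have h3 := two_form_smul_left Ω t b a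
  rw [h1, h3, h2]
  ring

/-- `Ω(a, a) = 0`. [folklore] -/
theorem two_form_self (Ω : (EuclideanSpace ℝ (Fin 4)) [⋀^Fin 2]→L[ℝ] ℝ) (a : (EuclideanSpace ℝ (Fin 4))) : Ω ![a, a] = 0 := by
  have h := two_form_swap Ω a a
  linarith

/-! ### The bracket `E(α, Ω)` is trilinear and alternating -/

/-- Linearity of the bracket in its first vector argument. [folklore] -/
theorem isLinearMap_bracket_fst (α : (EuclideanSpace ℝ (Fin 4)) →L[ℝ] ℝ) (Ω : (EuclideanSpace ℝ (Fin 4)) [⋀^Fin 2]→L[ℝ] ℝ) (b c : (EuclideanSpace ℝ (Fin 4))) :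
    IsLinearMap ℝ fun a : (EuclideanSpace ℝ (Fin 4)) => α a * Ω ![b, c] - α b * Ω ![a, c] + α c * Ω ![a, b] := by
  constructor
  · intro x y
    simp only [map_add, two_form_add_left]
    ring
  · intro t x
    simp only [map_smul, smul_eq_mul, two_form_smul_left]
    ring

/-- Linearity of the bracket in its second vector argument. [folklore] -/
theorem isLinearMap_bracket_snd (α : (EuclideanSpace ℝ (Fin 4)) →L[ℝ] ℝ) (Ω : (EuclideanSpace ℝ (Fin 4)) [⋀^Fin 2]→L[ℝ] ℝ) (a c : (EuclideanSpace ℝ (Fin 4))) :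
    IsLinearMap ℝ fun b : (EuclideanSpace ℝ (Fin 4)) => α a * Ω ![b, c] - α b * Ω ![a, c] + α c * Ω ![a, b] := by
  constructor
  · intro x y
    simp only [map_add, two_form_add_left, two_form_add_right]
    ring
  · intro t x
    simp only [map_smul, smul_eq_mul, two_form_smul_left, two_form_smul_right]
    ring

/-- Linearity of the bracket in its third vector argument. [folklore] -/
theorem isLinearMap_bracket_thd (α : (EuclideanSpace ℝ (Fin 4)) →L[ℝ] ℝ) (Ω : (EuclideanSpace ℝ (Fin 4)) [⋀^Fin 2]→L[ℝ] ℝ) (a b : (EuclideanSpace ℝ (Fin 4))) :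
    IsLinearMap ℝ fun c : (EuclideanSpace ℝ (Fin 4)) => α a * Ω ![b, c] - α b * Ω ![a, c] + α c * Ω ![a, b] := by
  constructor
  · intro x y
    simp only [map_add, two_form_add_right]
    ring
  · intro t x
    simp only [map_smul, smul_eq_mul, two_form_smul_right]
    ring

/-- Antisymmetry of the bracket in its first two arguments. [folklore] -/
theorem bracket_swap₁₂ (α : (EuclideanSpace ℝ (Fin 4)) →L[ℝ] ℝ) (Ω : (EuclideanSpace ℝ (Fin 4)) [⋀^Fin 2]→L[ℝ] ℝ) (a b c : (EuclideanSpace ℝ (Fin 4))) :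
    α b * Ω ![a, c] - α a * Ω ![b, c] + α c * Ω ![b, a] =
      - (α a * Ω ![b, c] - α b * Ω ![a, c] + α c * Ω ![a, b]) := by
  rw [two_form_swap Ω a b]
  ring

/-- Antisymmetry of the bracket in its last two arguments. [folklore] -/
theorem bracket_swap₂₃ (α : (EuclideanSpace ℝ (Fin 4)) →L[ℝ] ℝ) (Ω : (EuclideanSpace ℝ (Fin 4)) [⋀^Fin 2]→L[ℝ] ℝ) (a b c : (EuclideanSpace ℝ (Fin 4))) :
    α a * Ω ![c, b] - α c * Ω ![a, b] + α b * Ω ![a, c] =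
      - (α a * Ω ![b, c] - α b * Ω ![a, c] + α c * Ω ![a, b]) := by
  rw [two_form_swap Ω b c]
  ring

/-! ### Operator-norm bounds -/

/-- Operator-norm bound for a `2`-form on a pair. [folklore] -/
theorem abs_two_form_le (Ω : (EuclideanSpace ℝ (Fin 4)) [⋀^Fin 2]→L[ℝ] ℝ) (a b : (EuclideanSpace ℝ (Fin 4))) :
    |Ω ![a, b]| ≤ ‖Ω‖ * ‖a‖ * ‖b‖ := by
  have := Ω.le_opNorm ![a, b]
  simp only [Fin.prod_univ_two, Matrix.cons_val_zero, Matrix.cons_val_one,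
    Real.norm_eq_abs] at this
  simpa [mul_assoc] using this

/-- The bracket `E(α, Ω)(a, b, c) = α(a)Ω(b,c) - α(b)Ω(a,c) + α(c)Ω(a,b)` (the wedge `α ∧ Ω` of a
covector and a 2-form) is bounded by `3 ‖α‖ ‖Ω‖ ‖a‖ ‖b‖ ‖c‖`. [folklore] -/
theorem abs_bracket_le (α : (EuclideanSpace ℝ (Fin 4)) →L[ℝ] ℝ) (Ω : (EuclideanSpace ℝ (Fin 4)) [⋀^Fin 2]→L[ℝ] ℝ) (a b c : (EuclideanSpace ℝ (Fin 4))) :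
    |α a * Ω ![b, c] - α b * Ω ![a, c] + α c * Ω ![a, b]| ≤
      3 * ‖α‖ * ‖Ω‖ * ‖a‖ * ‖b‖ * ‖c‖ := by
  have ha : |α a| ≤ ‖α‖ * ‖a‖ := by rw [← Real.norm_eq_abs]; exact α.le_opNorm a
  have hb : |α b| ≤ ‖α‖ * ‖b‖ := by rw [← Real.norm_eq_abs]; exact α.le_opNorm b
  have hc : |α c| ≤ ‖α‖ * ‖c‖ := by rw [← Real.norm_eq_abs]; exact α.le_opNorm c
  have h1 := abs_two_form_le Ω b c
  have h2 := abs_two_form_le Ω a c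
  have h3 := abs_two_form_le Ω a b
  have e1 : |α a * Ω ![b, c]| ≤ ‖α‖ * ‖Ω‖ * ‖a‖ * ‖b‖ * ‖c‖ := by
    rw [abs_mul]
    calc |α a| * |Ω ![b, c]| ≤ (‖α‖ * ‖a‖) * (‖Ω‖ * ‖b‖ * ‖c‖) :=
          mul_le_mul ha h1 (abs_nonneg _) (by positivity)
      _ = ‖α‖ * ‖Ω‖ * ‖a‖ * ‖b‖ * ‖c‖ := by ring
  have e2 : |α b * Ω ![a, c]| ≤ ‖α‖ * ‖Ω‖ * ‖a‖ * ‖b‖ * ‖c‖ := by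
    rw [abs_mul]
    calc |α b| * |Ω ![a, c]| ≤ (‖α‖ * ‖b‖) * (‖Ω‖ * ‖a‖ * ‖c‖) :=
          mul_le_mul hb h2 (abs_nonneg _) (by positivity)
      _ = ‖α‖ * ‖Ω‖ * ‖a‖ * ‖b‖ * ‖c‖ := by ring
  have e3 : |α c * Ω ![a, b]| ≤ ‖α‖ * ‖Ω‖ * ‖a‖ * ‖b‖ * ‖c‖ := by
    rw [abs_mul]
    calc |α c| * |Ω ![a, b]| ≤ (‖α‖ * ‖c‖) * (‖Ω‖ * ‖a‖ * ‖b‖) :=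
          mul_le_mul hc h3 (abs_nonneg _) (by positivity)
      _ = ‖α‖ * ‖Ω‖ * ‖a‖ * ‖b‖ * ‖c‖ := by ring
  have t1 := abs_add_le (α a * Ω ![b, c] - α b * Ω ![a, c]) (α c * Ω ![a, b])
  have t2 := abs_sub (α a * Ω ![b, c]) (α b * Ω ![a, c])
  linarith

/-! ### A frame orthogonal to a unit vector has nonzero determinant -/

/-- A linearly independent triple `v` orthogonal to a unit vector `u` completes it to a frame:
`det[u, v₀, v₁, v₂] ≠ 0` (same statement and proof as the line's
`StableSeamHost.det_finCons_ne_zero`, repeated here because a `Literature` file cannot import a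
`Summits` one). [folklore] -/
theorem det_finCons_ne_zero (u : (EuclideanSpace ℝ (Fin 4))) (hu : ‖u‖ = 1) (v : Fin 3 → (EuclideanSpace ℝ (Fin 4))) (hvu : ∀ i, ⟪v i, u⟫ = 0)
    (hv : LinearIndependent ℝ v) :
    (Matrix.of fun i j => (Fin.cons u v : Fin 4 → (EuclideanSpace ℝ (Fin 4))) i j).det ≠ 0 := by
  have hnot : u ∉ Submodule.span ℝ (range v) := by
    intro hmem
    have hle : Submodule.span ℝ (range v) ≤ (ℝ ∙ u)ᗮ := by
      rw [Submodule.span_le]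
      rintro _ ⟨i, rfl⟩
      exact Submodule.mem_orthogonal_singleton_iff_inner_left.2 (hvu i)
    have h0 : ⟪u, u⟫ = 0 := Submodule.mem_orthogonal_singleton_iff_inner_left.1 (hle hmem)
    rw [real_inner_self_eq_norm_sq, hu] at h0
    norm_num at h0
  have hw : LinearIndependent ℝ (Fin.cons u v : Fin 4 → (EuclideanSpace ℝ (Fin 4))) := hv.finCons hnot
  have hrows : LinearIndependent ℝ (Matrix.of fun i j => (Fin.cons u v : Fin 4 → (EuclideanSpace ℝ (Fin 4))) i j).row :=
    hw.map' (WithLp.linearEquiv 2 ℝ (Fin 4 → ℝ)).toLinearMap (LinearEquiv.ker _)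
  have hunit := Matrix.linearIndependent_rows_iff_isUnit.1 hrows
  rw [Matrix.isUnit_iff_isUnit_det, isUnit_iff_ne_zero] at hunit
  exact hunit

/-! ### The perturbation lemma for the contact clause -/

/-- THE CONTACT CLAUSE UNDER PERTURBATION.  Let `Ω₀` be a 2-form on `ℝ⁴` with nonzero Pfaffian
`P`, satisfying the Pfaffian identity `½ Ω₀ ∧ Ω₀ = P · det`; let `u` be a unit vector,
`θ₀(a) = ½ Ω₀(u, a)` the model covector, and `θ`, `Ω` perturbations with
`3 (‖θ - θ₀‖ ‖Ω‖ + ‖θ₀‖ ‖Ω - Ω₀‖) < |P| / 2`.  Then, granted that alternating trilinear forms on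
`u^⊥` are `det[u,·,·,·]`-proportional with the stated bound (hypothesis `hprop`, the tree's
`alternating_three_restrict_orthogonal_four`), the bracket `θ ∧ Ω` does not vanish on any
linearly independent triple `v ⊥ u`.  Proof: `θ ∧ Ω = θ₀ ∧ Ω₀ + R` with `R` alternating
trilinear of norm `≤ δ`, `θ₀ ∧ Ω₀ = ½ P det[u, ·]` by the Pfaffian identity, `R = κ det[u, ·]` on
`u^⊥` with `|κ| ≤ δ < |P|/2`, and `det[u, v] ≠ 0`. [folklore] -/
theorem bracket_ne_zero_of_perturbation (Ω₀ : (EuclideanSpace ℝ (Fin 4)) [⋀^Fin 2]→L[ℝ] ℝ) (P : ℝ)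
    (hPf : ∀ w : Fin 4 → (EuclideanSpace ℝ (Fin 4)), Ω₀ ![w 0, w 1] * Ω₀ ![w 2, w 3] - Ω₀ ![w 0, w 2] * Ω₀ ![w 1, w 3] +
      Ω₀ ![w 0, w 3] * Ω₀ ![w 1, w 2] = P * (Matrix.of fun i j => w i j).det)
    (hprop : ∀ (R : (EuclideanSpace ℝ (Fin 4)) → (EuclideanSpace ℝ (Fin 4)) → (EuclideanSpace ℝ (Fin 4)) → ℝ), (∀ b c, IsLinearMap ℝ fun a => R a b c) →
      (∀ a c, IsLinearMap ℝ fun b => R a b c) → (∀ a b, IsLinearMap ℝ fun c => R a b c) →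
      (∀ a b c, R b a c = - R a b c) → (∀ a b c, R a c b = - R a b c) →
      ∀ u : (EuclideanSpace ℝ (Fin 4)), ‖u‖ = 1 → ∃ κ : ℝ, (∀ v : Fin 3 → (EuclideanSpace ℝ (Fin 4)), (∀ i, ⟪v i, u⟫ = 0) →
        R (v 0) (v 1) (v 2) = κ * (Matrix.of fun i j => (Fin.cons u v : Fin 4 → (EuclideanSpace ℝ (Fin 4))) i j).det) ∧
        ∀ δ : ℝ, (∀ a b c, |R a b c| ≤ δ * ‖a‖ * ‖b‖ * ‖c‖) → |κ| ≤ δ)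
    (u : (EuclideanSpace ℝ (Fin 4))) (hu : ‖u‖ = 1) (θ θ₀ : (EuclideanSpace ℝ (Fin 4)) →L[ℝ] ℝ) (hθ₀ : ∀ a, θ₀ a = 2⁻¹ * Ω₀ ![u, a])
    (Ω : (EuclideanSpace ℝ (Fin 4)) [⋀^Fin 2]→L[ℝ] ℝ)
    (hsmall : 3 * (‖θ - θ₀‖ * ‖Ω‖ + ‖θ₀‖ * ‖Ω - Ω₀‖) < |P| / 2)
    (v : Fin 3 → (EuclideanSpace ℝ (Fin 4))) (hvu : ∀ i, ⟪v i, u⟫ = 0) (hv : LinearIndependent ℝ v) :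
    θ (v 0) * Ω ![v 1, v 2] - θ (v 1) * Ω ![v 0, v 2] + θ (v 2) * Ω ![v 0, v 1] ≠ 0 := by
  -- the error term `R = (θ - θ₀) ∧ Ω + θ₀ ∧ (Ω - Ω₀)`
  set R : (EuclideanSpace ℝ (Fin 4)) → (EuclideanSpace ℝ (Fin 4)) → (EuclideanSpace ℝ (Fin 4)) → ℝ := fun a b c =>
    ((θ - θ₀) a * Ω ![b, c] - (θ - θ₀) b * Ω ![a, c] + (θ - θ₀) c * Ω ![a, b]) +
      (θ₀ a * (Ω - Ω₀) ![b, c] - θ₀ b * (Ω - Ω₀) ![a, c] + θ₀ c * (Ω - Ω₀) ![a, b]) with hR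
  have hRdef : ∀ a b c, θ a * Ω ![b, c] - θ b * Ω ![a, c] + θ c * Ω ![a, b] =
      (θ₀ a * Ω₀ ![b, c] - θ₀ b * Ω₀ ![a, c] + θ₀ c * Ω₀ ![a, b]) + R a b c := by
    intro a b c
    simp only [hR, FunLike.coe_sub, Pi.sub_apply, ContinuousAlternatingMap.sub_apply]
    ring
  -- `R` is trilinear and alternating
  have hR1 : ∀ b c, IsLinearMap ℝ fun a => R a b c := fun b c => by
    refine ⟨fun x y => ?_, fun t x => ?_⟩
    · have h1 := (isLinearMap_bracket_fst (θ - θ₀) Ω b c).map_add x y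
      have h2 := (isLinearMap_bracket_fst θ₀ (Ω - Ω₀) b c).map_add x y
      simp only [hR] at h1 h2 ⊢
      linear_combination h1 + h2
    · have h1 := (isLinearMap_bracket_fst (θ - θ₀) Ω b c).map_smul t x
      have h2 := (isLinearMap_bracket_fst θ₀ (Ω - Ω₀) b c).map_smul t x
      simp only [hR, smul_eq_mul] at h1 h2 ⊢
      linear_combination h1 + h2
  have hR2 : ∀ a c, IsLinearMap ℝ fun b => R a b c := fun a c => by
    refine ⟨fun x y => ?_, fun t x => ?_⟩
    · have h1 := (isLinearMap_bracket_snd (θ - θ₀) Ω a c).map_add x y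
      have h2 := (isLinearMap_bracket_snd θ₀ (Ω - Ω₀) a c).map_add x y
      simp only [hR] at h1 h2 ⊢
      linear_combination h1 + h2
    · have h1 := (isLinearMap_bracket_snd (θ - θ₀) Ω a c).map_smul t x
      have h2 := (isLinearMap_bracket_snd θ₀ (Ω - Ω₀) a c).map_smul t x
      simp only [hR, smul_eq_mul] at h1 h2 ⊢
      linear_combination h1 + h2
  have hR3 : ∀ a b, IsLinearMap ℝ fun c => R a b c := fun a b => by
    refine ⟨fun x y => ?_, fun t x => ?_⟩
    · have h1 := (isLinearMap_bracket_thd (θ - θ₀) Ω a b).map_add x y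
      have h2 := (isLinearMap_bracket_thd θ₀ (Ω - Ω₀) a b).map_add x y
      simp only [hR] at h1 h2 ⊢
      linear_combination h1 + h2
    · have h1 := (isLinearMap_bracket_thd (θ - θ₀) Ω a b).map_smul t x
      have h2 := (isLinearMap_bracket_thd θ₀ (Ω - Ω₀) a b).map_smul t x
      simp only [hR, smul_eq_mul] at h1 h2 ⊢
      linear_combination h1 + h2
  have hRs1 : ∀ a b c, R b a c = - R a b c := by
    intro a b c
    simp only [hR]
    rw [two_form_swap Ω a b, two_form_swap (Ω - Ω₀) a b]
    ring
  have hRs2 : ∀ a b c, R a c b = - R a b c := by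
    intro a b c
    simp only [hR]
    rw [two_form_swap Ω b c, two_form_swap (Ω - Ω₀) b c]
    ring
  -- the bound `|R a b c| ≤ δ ‖a‖ ‖b‖ ‖c‖`
  set δ : ℝ := 3 * (‖θ - θ₀‖ * ‖Ω‖ + ‖θ₀‖ * ‖Ω - Ω₀‖) with hδ
  have hRb : ∀ a b c, |R a b c| ≤ δ * ‖a‖ * ‖b‖ * ‖c‖ := by
    intro a b c
    have h1 := abs_bracket_le (θ - θ₀) Ω a b c
    have h2 := abs_bracket_le θ₀ (Ω - Ω₀) a b c
    have h3 := abs_add_le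
      ((θ - θ₀) a * Ω ![b, c] - (θ - θ₀) b * Ω ![a, c] + (θ - θ₀) c * Ω ![a, b])
      (θ₀ a * (Ω - Ω₀) ![b, c] - θ₀ b * (Ω - Ω₀) ![a, c] + θ₀ c * (Ω - Ω₀) ![a, b])
    have : δ * ‖a‖ * ‖b‖ * ‖c‖ =
        3 * ‖θ - θ₀‖ * ‖Ω‖ * ‖a‖ * ‖b‖ * ‖c‖ + 3 * ‖θ₀‖ * ‖Ω - Ω₀‖ * ‖a‖ * ‖b‖ * ‖c‖ := by
      rw [hδ]; ring
    rw [this]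
    exact h3.trans (add_le_add h1 h2)
  -- proportionality on `u^⊥`
  obtain ⟨κ, hκ, hκb⟩ := hprop R hR1 hR2 hR3 hRs1 hRs2 u hu
  have hκδ : |κ| ≤ δ := hκb δ hRb
  -- the model value `θ₀ ∧ Ω₀ = ½ P det[u, ·]`
  have hmodel : θ₀ (v 0) * Ω₀ ![v 1, v 2] - θ₀ (v 1) * Ω₀ ![v 0, v 2] + θ₀ (v 2) * Ω₀ ![v 0, v 1] =
      2⁻¹ * P * (Matrix.of fun i j => (Fin.cons u v : Fin 4 → (EuclideanSpace ℝ (Fin 4))) i j).det := by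
    have h := hPf (Fin.cons u v)
    have e0 : (Fin.cons u v : Fin 4 → (EuclideanSpace ℝ (Fin 4))) 0 = u := rfl
    have e1 : (Fin.cons u v : Fin 4 → (EuclideanSpace ℝ (Fin 4))) 1 = v 0 := rfl
    have e2 : (Fin.cons u v : Fin 4 → (EuclideanSpace ℝ (Fin 4))) 2 = v 1 := rfl
    have e3 : (Fin.cons u v : Fin 4 → (EuclideanSpace ℝ (Fin 4))) 3 = v 2 := rfl
    rw [e0, e1, e2, e3] at h
    rw [hθ₀, hθ₀, hθ₀]
    have h' : Ω₀ ![u, v 0] * Ω₀ ![v 1, v 2] - Ω₀ ![u, v 1] * Ω₀ ![v 0, v 2] +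
        Ω₀ ![u, v 2] * Ω₀ ![v 0, v 1] = P * (Matrix.of fun i j => (Fin.cons u v : Fin 4 → (EuclideanSpace ℝ (Fin 4))) i j).det :=
      h
    calc 2⁻¹ * Ω₀ ![u, v 0] * Ω₀ ![v 1, v 2] - 2⁻¹ * Ω₀ ![u, v 1] * Ω₀ ![v 0, v 2] +
          2⁻¹ * Ω₀ ![u, v 2] * Ω₀ ![v 0, v 1]
        = 2⁻¹ * (Ω₀ ![u, v 0] * Ω₀ ![v 1, v 2] - Ω₀ ![u, v 1] * Ω₀ ![v 0, v 2] +
            Ω₀ ![u, v 2] * Ω₀ ![v 0, v 1]) := by ring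
      _ = 2⁻¹ * P * (Matrix.of fun i j => (Fin.cons u v : Fin 4 → (EuclideanSpace ℝ (Fin 4))) i j).det := by
          rw [h']; ring
  -- assemble
  have hdet := det_finCons_ne_zero u hu v hvu hv
  rw [hRdef, hmodel, hκ v hvu]
  have hcoef : 2⁻¹ * P + κ ≠ 0 := by
    intro h0
    have : |κ| = |P| / 2 := by
      have : κ = - (2⁻¹ * P) := by linarith
      rw [this, abs_neg, abs_mul, abs_of_pos (by norm_num : (0 : ℝ) < 2⁻¹)]
      ring
    have hδlt : δ < |P| / 2 := hsmall
    linarith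
  have : 2⁻¹ * P * (Matrix.of fun i j => (Fin.cons u v : Fin 4 → (EuclideanSpace ℝ (Fin 4))) i j).det +
      κ * (Matrix.of fun i j => (Fin.cons u v : Fin 4 → (EuclideanSpace ℝ (Fin 4))) i j).det =
        (2⁻¹ * P + κ) * (Matrix.of fun i j => (Fin.cons u v : Fin 4 → (EuclideanSpace ℝ (Fin 4))) i j).det := by ring
  rw [this]
  exact mul_ne_zero hcoef hdet

end Literature.Geometry.Symplectic

end
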